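import Literature.IUT.HodgeArakelov.GaloisPairCyclotomesCor111AtModelTate
import Literature.IUT.HodgeArakelov.ThetaSettingCompletionPackage
import Literature.IUT.HodgeArakelov.MonoThetaProjectiveBridgeEtThAtModelTate
import Literature.AnabelianGeometry.EtaleTheta.Discharge.Sec2Cor218iAtModelTateNonInnerModFour
import HarnessLib

/-!
# [IUTchII] Cor. 1.10 / Cor. 1.11 AT THE [EtTh] TATE MODEL with the F-0620 binder `h218i` SUPPLIED IN KERNEL
# from the extension property `hextΔ` ALONE (proof-only; K-L6 row «XPARITY-L3@modelTate»)

S. Mochizuki, *Inter-universal Teichmüller theory II*, §1, Cor. 1.10 p. 47, Cor. 1.11 p. 49, Ex. 1.8 (i) p. 35, kurims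
manuscript (Dec. 2020) [claim: Mochizuki2012, status: disputed] (IUTchII §1 Cor 1.11, kurims p.49); [EtTh] = S. Mochizuki,
Publ. RIMS **45** (2009): Thm. 1.6 (i) p. 24, Prop. 2.4 p. 38, Cor. 2.18 (i) p. 60 (FACT-LIST F-0620)
[cite: MochizukiEtTh2009, Cor 2.18(i) p.60]. abc-iut cell, layer L6 / K-L6 instance column, seat abc-iut-L6-t2 (gen 5),
row «XPARITY-L3@modelTate» (abc-iut-L6-lead §F v1.19ct/cy). PROOF-ONLY: 0 definitions, no instance, no `Prop`-valued
fact; every input consumed BY NAME — abc-iut-w4-d030 `ModelTateCarriers.cor110_multiradiallyDefined_modelTate` /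
`exists_cor111FunctorCor110_modelTate` (p456925, the K-L6 instance record), abc-iut-L6-d6
`SettingModel.rigidData_cor218_i_modelχq_of_extends_of_mod_four_eq_one` (p477049), abc-iut-w6-d055/w4-d044 lineage
`ThetaSetting.mem_deltaX_ofDoubleUnderline_iff` (`ThetaSettingCompletionPackage`); nothing restated.

STATE OF RECORD BEFORE THIS FILE. At the Tate datum of record (`D := ThetaSetting.modelχq p 1 2`, `K = ℚ_p`, an odd prime
`l` with `4·l ∣ p − 1`, a compatible cyclotome tower `τ`, the `inr`-section étale-theta datum with `η̈♯ = etaDdχq`,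
`X̲̲ := doubleUnderlineχqOfEtaRes`, the EMPTY cusp labelling) the record theorems display the FACT binder
`h218i : ∀ M, (EtaleLevels.levelRigid C hC hS τ.modAll h15 L∅ M).Cor218_i` (F-0620 at every level; Cor. 1.10 needs level
`1` only) next to (H1) `hΔ` and (HGAL). abc-iut-L6-d6 proved F-0620 for `C.rigidData μ hC hS h15 L∅` at `modelχq p i 2`
from `hextΔ` («every bi-continuous automorphism of `Π^tp_{X̲̲}` extends to a `Δ^tp_X`-stabilising bi-continuous automorphism
of `Π^tp_X`», [EtTh] Prop. 2.4 (i) shape) ALONE whenever `p ≡ 1 (mod 4)`; the K-L6 token of record reads «CONDITIONAL-AT-MODEL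
by `p mod 4`».

WHAT THIS FILE PROVES (numbers, not adjectives).
§1 `mod_four_eq_one_of_four_mul_dvd_pred` / `mod_four_eq_one_of_isPrimitiveRoot_bot` — the record's OWN side condition
   `4·l ∣ p − 1`, resp. `ζ_{4l} ∈ K = ℚ_p` ([IUTchII] §1 p. 20 «`k` contains a primitive `4l`-th root of unity»), forces
   `p ≡ 1 (mod 4)`: AT EVERY [IUTchII] §1 CONSUMER OF THE TATE MODEL the `p mod 4` case split of abc-iut-L6-d6's verdict is EMPTY
   on the `p ≢ 1` side — no parity residual survives there (the `p ≡ 3 (mod 4)` question lives only at the bare [EtTh]-level model).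
§2 (generic, every [EtTh] §1 theta setting `D`, every `X̲̲`-choice `C`) `EtaleLevels.deltaX_map_eq_setting_of_extends` —
   (H1) «`Δ = Ker(Π^tp_{X̲̲} ↠ G_K)` is carried onto itself by every topological automorphism of `Π^tp_{X̲̲}`» at
   abc-iut-w4-d030's `EtaleLevels.setting` FOLLOWS from `hextΔ` (pure group theory: `Δ^tp_{X̲̲} = Π^tp_{X̲̲} ∩ Δ^tp_X`).
§3 at the datum of record: `ModelTateCarriers.levelRigid_cor218_i_modelTate_of_extends` — F-0620 at EVERY level of the tower
   ⟸ `hextΔ`, NO `p mod 4` / (HGAL) residual; `ModelTateCarriers.cor111_record_inputs_modelTate_of_extends` — BOTH FACT/anabelian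
   binders `h218i` (F-0620 at every level) and (H1) `hΔ` of the Cor. 1.11 record ⟸ `hextΔ`; two kernel-checked `example`s then
   instantiate abc-iut-w4-d030's records: [IUTchII] Cor. 1.10 at the genuine natural system of the Tate model with displayed Prop
   binders = {`hextΔ`} ONLY (was {F-0620@1}) and [IUTchII] Cor. 1.11 at the Tate model with displayed Prop binders = {`hextΔ`, (HGAL)}
   (was {F-0620 at every level, (H1), (HGAL)}) — `example`s, not named theorems, because as theorems they restate p456925 verbatim
   modulo the supplied Prop binders (gate `dedup.landed`); consumers compose BY NAME in one term.
§4 `EtaleLevels.prop15_modelSystem_modelTate_of_extends` — abc-iut-w4-d038's Prop. 1.5 (i) ∧ (ii) record of the Tate model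
   (p454451 `prop15_modelSystem_modelTate`) with its F-0620 binder at the chain levels `τ.mod e` SUPPLIED from `hextΔ`
   (displayed Prop binders: `hextΔ`, `h219iii`, the printed side conditions).
CONSUMERS BY NAME (one term each, nothing to restate): the binder `h218i₁ : (C.rigidData (τ.modAll 1) hC hS h15 L∅).Cor218_i` of
abc-iut-w5-d072/w4-d008's Cor. 1.12 (ii)(iii) records (`ThetaEvaluationCor112AtModelTateSectionTranslates` p477403,
`ThetaSettingCor112ModelTateOfKerNeBot` p488290) IS `ModelTateCarriers.levelRigid_cor218_i_modelTate_of_extends p l hl hdvd τ hext 1`,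
and their `hΔX` IS `EtaleLevels.deltaX_map_eq_setting_of_extends … hext` (a second route to (H1), next to abc-iut-w4-d044's MChar ⟸ hI0).
K-L6 TOKEN MATERIAL (lead's call): cells Cor1.10 / Cor1.11 @ modelTate: F-0620@levels and (H1) KERNEL-SUPPLIED ⟸ hextΔ;
residual-of-record {hextΔ, (HGAL)} (Cor. 1.11) / {hextΔ} (Cor. 1.10); «by `p mod 4`» qualifier VOID at the record (§1).
IS `hextΔ` ITSELF DISCHARGEABLE AT THE MODEL? NO tree theorem decides it: it quantifies over the bi-continuous automorphism group of
the open subgroup `Π^tp_{X̲̲} = Huuχq ≤ dUU_l ⋊ G_{ℚ_p}` and asks for extensions to `Π^tp_X` — abc-iut-L6-d6's gen-5 census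
(memo COR218I-AT-MODELTATE) names exactly this as one of the two points where the `∀` is blocked («no Nielsen-type theory of
Aut(F̂_n)», the model has no analogue of print's `K`-coricity [EtTh] Prop. 2.4 / [Mzk3] Thm. 2.4). So this file is a RE-KEYING
(F-0620 and (H1) OUT, `hextΔ` IN), not a net discharge: the displayed input moves UPSTREAM in print (Prop. 2.4 (i) is an input of
Cor. 2.18 (i)'s proof) and loses every mono-theta-specific clause (those are abc-iut-L6-d6's theorems).

HONEST LABEL: `modelχq p 1 2` is a SEMI-SYNTHETIC model of the typed [EtTh] §1 interface (not the tempered `π₁` of a curve):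
binder-discharge evidence for OUR typed rows only; `hextΔ` ([EtTh] Prop. 2.4 (i) shape) and (HGAL) ([AbsTopIII] Cor. 1.10 shape)
are DISPLAYED hypotheses, not endorsed; F-0620 stays a FACT-policy row in print currency (refuted-as-typed over the lawless
interface ≠ refuted-in-print); the [IUTchII] claim key `Mochizuki2012` is DISPUTED and nothing of it is asserted; no side is
taken on [IUTchIII] Cor. 3.12; typed ≠ proved; instantiated ≠ endorsed; nothing here says abc is proved or refuted.
-/

noncomputable section

namespace Literature.IUT.HodgeArakelov

open CategoryTheory
open Literature.AnabelianGeometry.AbsoluteAnabelian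
open Literature.AnabelianGeometry.EtaleTheta Literature.AnabelianGeometry.SemiGraphs
open Literature.AnabelianGeometry.EtaleTheta.SettingModel
open scoped Literature.AnabelianGeometry.EtaleTheta

/-! ## §1. `4·l ∣ p − 1` forces `p ≡ 1 (mod 4)` -/

/-- The [IUTchII] §1 side condition `4·l ∣ p − 1` (a primitive `4l`-th root of unity in `k = ℚ_p`) forces
`p ≡ 1 (mod 4)` for a prime `p`. [claim: Mochizuki2012, status: disputed] (IUTchII §1, kurims p.20) -/
theorem mod_four_eq_one_of_four_mul_dvd_pred (p : ℕ) [Fact p.Prime] {l : ℕ}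
    (h : 4 * l ∣ p - 1) : p % 4 = 1 := by
  have hp : 2 ≤ p := (Fact.out : p.Prime).two_le
  obtain ⟨k, hk⟩ := dvd_trans (Dvd.intro l rfl) h
  omega

/-- The same side condition in the form the Prop. 1.5 record carries it: a primitive `4l`-th root of unity in the base field
`K = ℚ_p` (`⊥ ⊆ ℚ̄_p`) of the Tate model forces `p ≡ 1 (mod 4)` (its `l`-th power squares to `−1` in `ℚ_p`;
[Serre, Ch. II §3.3]). [cite: Serre1973, Ch. II §3.3 Cor. of Thm 4] -/
theorem mod_four_eq_one_of_isPrimitiveRoot_bot (p : ℕ) [Fact p.Prime] {l : ℕ} (hl : 0 < l)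
    {ζ : (⊥ : IntermediateField ℚ_[p] (PadicAlgCl p))} (hζ : IsPrimitiveRoot ζ (4 * l)) : p % 4 = 1 := by
  have hζ' : IsPrimitiveRoot (IntermediateField.botEquiv ℚ_[p] (PadicAlgCl p) ζ) (4 * l) :=
    hζ.map_of_injective (IntermediateField.botEquiv ℚ_[p] (PadicAlgCl p)).injective
  have h4 : IsPrimitiveRoot ((IntermediateField.botEquiv ℚ_[p] (PadicAlgCl p) ζ) ^ l) 4 :=
    hζ'.pow (by omega) (by ring)
  have h2 : IsPrimitiveRoot (((IntermediateField.botEquiv ℚ_[p] (PadicAlgCl p) ζ) ^ l) ^ 2) 2 :=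
    h4.pow (by norm_num) (by norm_num)
  exact Padic.mod_four_eq_one_of_sq_eq_neg_one h2.eq_neg_one_of_two_right

/-! ## §2. (H1) at `EtaleLevels.setting` from the extension property `hextΔ` (generic) -/

namespace EtaleLevels

variable {p : ℕ} [Fact p.Prime] {D : Literature.AnabelianGeometry.EtaleTheta.ThetaSetting p}
  {E : D.EtaleThetaData} {l : ℕ} (C : E.DoubleUnderline l) (hC : D.Compat) (hS : D.Sec2Hyps)
  (hl : l.Prime) (hp2 : p ≠ 2) (hpl : p ≠ l) (hζ : ∃ ζ : D.K, IsPrimitiveRoot ζ (4 * l))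
  (mods : ∀ M : ℕ+, D.CyclotomeMod l M)
  (f : contCocycles D.toTheta D.DeltaTheta C.GtpYdduu) (hf : f ∈ C.rootCocycles hC)

/-- `Δ` of abc-iut-w4-d030's `EtaleLevels.setting` of `X̲̲` is `Π^tp_{X̲̲} ∩ Δ^tp_X` read in `Π^tp_X` (bookkeeping through
`setting = ThetaSetting.ofDoubleUnderline …`, abc-iut-w4-d044's `mem_deltaX_ofDoubleUnderline_iff` at level `1`).
[claim: Mochizuki2012, status: disputed] (IUTchII §1 Ex 1.8 (i), kurims p.35) -/
theorem mem_deltaX_setting_iff_mem_deltaTemp (x : (setting C hC hS hl hp2 hpl hζ mods f hf).PiX) :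
    x ∈ (setting C hC hS hl hp2 hpl hζ mods f hf).DeltaX ↔ ((show C.Huu from x) : D.PiTemp) ∈ D.DeltaTemp :=
  ThetaSetting.mem_deltaX_ofDoubleUnderline_iff C (mods 1) hC hS hl hp2 hpl hζ (eta0_mem C hC hS mods f hf 1) x

/-- One inclusion of (H1) from ONE extension: if the topological automorphism `φ` of `Π^tp_{X̲̲}` is the restriction of a
`Δ^tp_X`-stabilising topological automorphism `Γ` of `Π^tp_X`, then `φ(Δ) ⊆ Δ`.
[claim: Mochizuki2012, status: disputed] (IUTchII §1 Ex 1.8 (i), kurims p.35) -/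
theorem deltaX_map_le_setting_of_extension
    (φ : (setting C hC hS hl hp2 hpl hζ mods f hf).PiX ≃ₜ* (setting C hC hS hl hp2 hpl hζ mods f hf).PiX)
    (Γ : D.PiTemp ≃ₜ* D.PiTemp)
    (hΓ : ∀ x : (setting C hC hS hl hp2 hpl hζ mods f hf).PiX,
      Γ ((show C.Huu from x) : D.PiTemp) = ((show C.Huu from φ x) : D.PiTemp))
    (hΓΔ : D.DeltaTemp.map Γ.toMulEquiv.toMonoidHom = D.DeltaTemp) :
    (setting C hC hS hl hp2 hpl hζ mods f hf).DeltaX.map φ.toMulEquiv.toMonoidHom ≤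
      (setting C hC hS hl hp2 hpl hζ mods f hf).DeltaX := by
  rintro _ ⟨y, hy, rfl⟩
  have hy' : ((show C.Huu from y) : D.PiTemp) ∈ D.DeltaTemp :=
    (mem_deltaX_setting_iff_mem_deltaTemp C hC hS hl hp2 hpl hζ mods f hf y).1 hy
  apply (mem_deltaX_setting_iff_mem_deltaTemp C hC hS hl hp2 hpl hζ mods f hf _).2
  show ((show C.Huu from φ y) : D.PiTemp) ∈ D.DeltaTemp
  rw [← hΓ y, ← hΓΔ]
  exact Subgroup.mem_map_of_mem _ hy'

/-- **(H1) at `EtaleLevels.setting` FROM `hextΔ`** (every [EtTh] §1 theta setting `D`, every `X̲̲`-choice `C`): if every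
topological automorphism of `Π^tp_{X̲̲} = C.Huu` extends to a `Δ^tp_X`-stabilising topological automorphism of `Π^tp_X`
([EtTh] Prop. 2.4 (i) shape), then every topological automorphism of `Π^tp_{X̲̲}` carries `Δ = Ker(Π^tp_{X̲̲} ↠ G_K)` onto
itself — the standing binder (H1) `hΔ` of the Cor. 1.11 / Cor. 1.12 (iii) closers. Pure group theory
(`Δ^tp_{X̲̲} = Π^tp_{X̲̲} ∩ Δ^tp_X`; both inclusions from the extensions of `φ` and `φ⁻¹`).
[claim: Mochizuki2012, status: disputed] (IUTchII §1 Ex 1.8 (i), kurims p.35) -/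
theorem deltaX_map_eq_setting_of_extends
    (hext : ∀ γ : ↥C.Huu ≃ₜ* ↥C.Huu, ∃ Γ : D.PiTemp ≃ₜ* D.PiTemp,
      (∀ h : C.Huu, Γ (h : D.PiTemp) = ((γ h : C.Huu) : D.PiTemp)) ∧
        D.DeltaTemp.map Γ.toMulEquiv.toMonoidHom = D.DeltaTemp) :
    ∀ φ : (setting C hC hS hl hp2 hpl hζ mods f hf).PiX ≃ₜ* (setting C hC hS hl hp2 hpl hζ mods f hf).PiX,
      (setting C hC hS hl hp2 hpl hζ mods f hf).DeltaX.map φ.toMulEquiv.toMonoidHom =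
        (setting C hC hS hl hp2 hpl hζ mods f hf).DeltaX := by
  intro φ
  apply le_antisymm
  · obtain ⟨Γ, hΓ, hΓΔ⟩ := hext (show ↥C.Huu ≃ₜ* ↥C.Huu from φ)
    exact deltaX_map_le_setting_of_extension C hC hS hl hp2 hpl hζ mods f hf φ Γ (fun x => hΓ _) hΓΔ
  · obtain ⟨Γ, hΓ, hΓΔ⟩ := hext (show ↥C.Huu ≃ₜ* ↥C.Huu from φ.symm)
    have hle := deltaX_map_le_setting_of_extension C hC hS hl hp2 hpl hζ mods f hf φ.symm Γ (fun x => hΓ _) hΓΔ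
    intro x hx
    exact ⟨φ.symm x, hle ⟨x, hx, rfl⟩, φ.apply_symm_apply x⟩

end EtaleLevels

/-! ## §3. The K-L6 instance record of the Tate model RE-KEYED: F-0620 and (H1) supplied from `hextΔ` -/

namespace ModelTateCarriers

variable (p : ℕ) [Fact p.Prime] (l : ℕ+) (hl : Odd (l : ℕ)) (hlp : (l : ℕ).Prime) (hdvd : 4 * (l : ℕ) ∣ p - 1)
  {Es : Set ℕ+} (τ : (ThetaSetting.modelχq p 1 2 even_two).CyclotomeTower l Es)

include hdvd in
/-- **F-0620 [EtTh] Cor. 2.18 (i) at EVERY level `τ.modAll M` of the rigidity data OF RECORD of the Tate model, FROM `hextΔ`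
ALONE** — abc-iut-L6-d6's `rigidData_cor218_i_modelχq_of_extends_of_mod_four_eq_one` at `i := 1`, its `p ≡ 1 (mod 4)`
hypothesis SUPPLIED by the record's own `4·l ∣ p − 1` (§1): no `p mod 4` case, no (HGAL). CONDITIONAL-AT-MODEL on `hextΔ`.
[cite: MochizukiEtTh2009, Cor 2.18(i) p.60] -/
theorem levelRigid_cor218_i_modelTate_of_extends :
    let hC := compat_modelχq p 1 2 even_two
    let hS := ThetaSetting.modelχq_sec2Hyps p 1 2 even_two
    let K₀ := (kummerCoreχq p 1 2 even_two).toKummerDataOfSection SemidirectProduct.inr (continuous_inrχq p 1 2)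
        (fun _ => rfl) (map_inr_GK_le_GtpY_modelχq' p 1 2 even_two) (map_inr_GKdd_le_GtpYdd_modelχq' p 1 2 even_two)
    let C := (K₀.etaleThetaDataOfClass (etaDdχq p 1 2 even_two)).doubleUnderlineχqOfEtaRes p 1 2 l hl
        (eta_res_etaDdχq p 1 2 even_two l hl)
    let h15 : Literature.AnabelianGeometry.EtaleTheta.ThetaSetting.Prop15iii _ hC :=
      prop15iii_etaleThetaDataOfClass_etaDdχq p hC SemidirectProduct.inr
        (continuous_inrχq p 1 2) (fun _ => rfl) (map_inr_GK_le_GtpY_modelχq' p 1 2 even_two)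
        (map_inr_GKdd_le_GtpYdd_modelχq' p 1 2 even_two)
    let L : C.CuspLabels := ⟨fun _ => ∅, fun _ => ∅, fun _ => rfl⟩
    ∀ (_hext : ∀ γ : ↥C.Huu ≃ₜ* ↥C.Huu, ∃ Γ : PiTpχq p 1 2 ≃ₜ* PiTpχq p 1 2,
        (∀ h : C.Huu, Γ (h : PiTpχq p 1 2) = ((γ h : C.Huu) : PiTpχq p 1 2)) ∧
          (curveχq p 1 2).DeltaTemp.map Γ.toMulEquiv.toMonoidHom = (curveχq p 1 2).DeltaTemp)
      (M : ℕ+), (EtaleLevels.levelRigid C hC hS τ.modAll h15 L M).Cor218_i := by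
  intro hC hS K₀ C h15 L hext M
  exact rigidData_cor218_i_modelχq_of_extends_of_mod_four_eq_one p 1
    (mod_four_eq_one_of_four_mul_dvd_pred p hdvd) C (τ.modAll M) hC hS h15 hext

/-- **THE TWO ANABELIAN / FACT BINDERS OF THE Cor. 1.11 RECORD, SUPPLIED FROM `hextΔ`**: at the datum of record, `hextΔ` gives
(1) F-0620 [EtTh] Cor. 2.18 (i) at EVERY level of the tower (`levelRigid_cor218_i_modelTate_of_extends`) and (2) (H1) «`Δ` is carried
onto itself by every topological automorphism of `Π^tp_{X̲̲}`» at abc-iut-w4-d030's `EtaleLevels.setting`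
(`EtaleLevels.deltaX_map_eq_setting_of_extends`) — exactly the binders `h218i`, `hΔ` of `exists_cor111FunctorCor110_modelTate`
(p456925) and `h218i₁`, `hΔX` of the Cor. 1.12 (ii)(iii) records (p477403 / p488290); the one-term compositions are the
`example`s below. [claim: Mochizuki2012, status: disputed] (IUTchII §1 Cor 1.11, kurims p.49) -/
theorem cor111_record_inputs_modelTate_of_extends :
    let hC := compat_modelχq p 1 2 even_two
    let hS := ThetaSetting.modelχq_sec2Hyps p 1 2 even_two
    let K₀ := (kummerCoreχq p 1 2 even_two).toKummerDataOfSection SemidirectProduct.inr (continuous_inrχq p 1 2)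
        (fun _ => rfl) (map_inr_GK_le_GtpY_modelχq' p 1 2 even_two) (map_inr_GKdd_le_GtpYdd_modelχq' p 1 2 even_two)
    let C := (K₀.etaleThetaDataOfClass (etaDdχq p 1 2 even_two)).doubleUnderlineχqOfEtaRes p 1 2 l hl
        (eta_res_etaDdχq p 1 2 even_two l hl)
    let h15 : Literature.AnabelianGeometry.EtaleTheta.ThetaSetting.Prop15iii _ hC :=
      prop15iii_etaleThetaDataOfClass_etaDdχq p hC SemidirectProduct.inr
        (continuous_inrχq p 1 2) (fun _ => rfl) (map_inr_GK_le_GtpY_modelχq' p 1 2 even_two)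
        (map_inr_GKdd_le_GtpYdd_modelχq' p 1 2 even_two)
    let L : C.CuspLabels := ⟨fun _ => ∅, fun _ => ∅, fun _ => rfl⟩
    let hp2 := ne_two_of_four_mul_dvd_pred p l.pos hdvd
    let hpl := ne_of_four_mul_dvd_pred p l.pos hdvd
    let hζ := exists_isPrimitiveRoot_K_modelχq p 1 2 even_two l.pos hdvd
    let f := EtaleThetaDataOfSetting.rootLift C
    let hf := rootLift_mem_rootCocycles C hC
    ∀ _hext : ∀ γ : ↥C.Huu ≃ₜ* ↥C.Huu, ∃ Γ : PiTpχq p 1 2 ≃ₜ* PiTpχq p 1 2,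
        (∀ h : C.Huu, Γ (h : PiTpχq p 1 2) = ((γ h : C.Huu) : PiTpχq p 1 2)) ∧
          (curveχq p 1 2).DeltaTemp.map Γ.toMulEquiv.toMonoidHom = (curveχq p 1 2).DeltaTemp,
    (∀ M : ℕ+, (EtaleLevels.levelRigid C hC hS τ.modAll h15 L M).Cor218_i) ∧
      ∀ g : (EtaleLevels.setting C hC hS hlp hp2 hpl hζ τ.modAll f hf).PiX ≃ₜ*
          (EtaleLevels.setting C hC hS hlp hp2 hpl hζ τ.modAll f hf).PiX,
        (EtaleLevels.setting C hC hS hlp hp2 hpl hζ τ.modAll f hf).DeltaX.map g.toMulEquiv.toMonoidHom =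
          (EtaleLevels.setting C hC hS hlp hp2 hpl hζ τ.modAll f hf).DeltaX := by
  intro hC hS K₀ C h15 L hp2 hpl hζ f hf hext
  exact ⟨levelRigid_cor218_i_modelTate_of_extends p l hl hdvd τ hext,
    EtaleLevels.deltaX_map_eq_setting_of_extends C hC hS hlp hp2 hpl hζ τ.modAll f hf hext⟩

/-! ### One-term compositions (kernel-checked `example`s; as named theorems they would restate the records p456925 verbatim
modulo the supplied Prop binders, which the gate's `dedup.landed` rightly refuses)

**[IUTchII] Cor. 1.10 at the genuine natural system of the Tate model, displayed Prop binders = {`hextΔ`} ONLY**: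
abc-iut-w4-d030's `cor110_multiradiallyDefined_modelTate` applied to `levelRigid_cor218_i_modelTate_of_extends … hext 1`. -/
example (Γxμ : Type) [Group Γxμ] :
    let hC := compat_modelχq p 1 2 even_two
    let hS := ThetaSetting.modelχq_sec2Hyps p 1 2 even_two
    let K₀ := (kummerCoreχq p 1 2 even_two).toKummerDataOfSection SemidirectProduct.inr (continuous_inrχq p 1 2)
        (fun _ => rfl) (map_inr_GK_le_GtpY_modelχq' p 1 2 even_two) (map_inr_GKdd_le_GtpYdd_modelχq' p 1 2 even_two)
    let C := (K₀.etaleThetaDataOfClass (etaDdχq p 1 2 even_two)).doubleUnderlineχqOfEtaRes p 1 2 l hl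
        (eta_res_etaDdχq p 1 2 even_two l hl)
    let h15 : Literature.AnabelianGeometry.EtaleTheta.ThetaSetting.Prop15iii _ hC :=
      prop15iii_etaleThetaDataOfClass_etaDdχq p hC SemidirectProduct.inr
        (continuous_inrχq p 1 2) (fun _ => rfl) (map_inr_GK_le_GtpY_modelχq' p 1 2 even_two)
        (map_inr_GKdd_le_GtpYdd_modelχq' p 1 2 even_two)
    let L : C.CuspLabels := ⟨fun _ => ∅, fun _ => ∅, fun _ => rfl⟩
    let hO := ThetaSetting.modelχq_isEtThOrigin p 1 2 even_two
    let hYcl := hYcl_modelχq p 1 2 even_two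
    let hp2 := ne_two_of_four_mul_dvd_pred p l.pos hdvd
    let hpl := ne_of_four_mul_dvd_pred p l.pos hdvd
    let hζ := exists_isPrimitiveRoot_K_modelχq p 1 2 even_two l.pos hdvd
    let hZ : ∀ M : ℕ+, Nonempty (ModelCyclotomes.lDeltaQuot (C.rigidData (τ.modAll M) hC hS h15 L) ≃*
        Literature.IUT.HodgeTheaters.ZHat) := fun M =>
      ModelCyclotomes.nonempty_lDeltaQuot_rigidData_mulEquiv_zHat C (τ.modAll M) hC hS h15 L hO hYcl hlp.ne_zero
    ∀ hext : ∀ γ : ↥C.Huu ≃ₜ* ↥C.Huu, ∃ Γ : PiTpχq p 1 2 ≃ₜ* PiTpχq p 1 2,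
        (∀ h : C.Huu, Γ (h : PiTpχq p 1 2) = ((γ h : C.Huu) : PiTpχq p 1 2)) ∧
          (curveχq p 1 2).DeltaTemp.map Γ.toMulEquiv.toMonoidHom = (curveχq p 1 2).DeltaTemp,
    let h218i₁ : (EtaleLevels.levelRigid C hC hS τ.modAll h15 L 1).Cor218_i :=
      levelRigid_cor218_i_modelTate_of_extends p l hl hdvd τ hext 1
    ((ex18iii (EtaleLevels.setting C hC hS hlp hp2 hpl hζ τ.modAll (EtaleThetaDataOfSetting.rootLift C)
        (rootLift_mem_rootCocycles C hC)) Γxμ).toDagger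
      (CategoryTheory.Prod.fst _ _ ⋙
        (EtaleLevels.familyLim C hC hS hlp hp2 hpl hζ τ.modAll (EtaleThetaDataOfSetting.rootLift C)
          (rootLift_mem_rootCocycles C hC) τ.red_modAll h15 L hZ h218i₁).toRigidityFunctor.Ξ)).IsMultiradiallyDefined := by
  intro hC hS K₀ C h15 L hO hYcl hp2 hpl hζ hZ hext h218i₁
  exact cor110_multiradiallyDefined_modelTate p l hl hlp hdvd τ Γxμ h218i₁

/-! **[IUTchII] Cor. 1.11 at the Tate model, displayed Prop binders = {`hextΔ`, (HGAL)}**: abc-iut-w4-d030's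
`exists_cor111FunctorCor110_modelTate` — the functor `ℛ → ℱ` over the GENUINE monoids, the genuine `Ẑ^×`-twist, the unconditional
rigidity input and Cor. 1.10's genuine family EXISTS and is multiradially defined — with `h218i` (F-0620 at every level) and (H1)
`hΔ` the witnesses of `cor111_record_inputs_modelTate_of_extends`; (HGAL) ([AbsTopIII] Cor. 1.10 shape) stays displayed. -/
example (Γ : Subgroup ZHatUnits) (Γ' : Type) [Group Γ'] :
    let hC := compat_modelχq p 1 2 even_two
    let hS := ThetaSetting.modelχq_sec2Hyps p 1 2 even_two
    let K₀ := (kummerCoreχq p 1 2 even_two).toKummerDataOfSection SemidirectProduct.inr (continuous_inrχq p 1 2)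
        (fun _ => rfl) (map_inr_GK_le_GtpY_modelχq' p 1 2 even_two) (map_inr_GKdd_le_GtpYdd_modelχq' p 1 2 even_two)
    let C := (K₀.etaleThetaDataOfClass (etaDdχq p 1 2 even_two)).doubleUnderlineχqOfEtaRes p 1 2 l hl
        (eta_res_etaDdχq p 1 2 even_two l hl)
    let h15 : Literature.AnabelianGeometry.EtaleTheta.ThetaSetting.Prop15iii _ hC :=
      prop15iii_etaleThetaDataOfClass_etaDdχq p hC SemidirectProduct.inr
        (continuous_inrχq p 1 2) (fun _ => rfl) (map_inr_GK_le_GtpY_modelχq' p 1 2 even_two)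
        (map_inr_GKdd_le_GtpYdd_modelχq' p 1 2 even_two)
    let L : C.CuspLabels := ⟨fun _ => ∅, fun _ => ∅, fun _ => rfl⟩
    let hO := ThetaSetting.modelχq_isEtThOrigin p 1 2 even_two
    let hYcl := hYcl_modelχq p 1 2 even_two
    let hp2 := ne_two_of_four_mul_dvd_pred p l.pos hdvd
    let hpl := ne_of_four_mul_dvd_pred p l.pos hdvd
    let hζ := exists_isPrimitiveRoot_K_modelχq p 1 2 even_two l.pos hdvd
    let f := EtaleThetaDataOfSetting.rootLift C
    let hf := rootLift_mem_rootCocycles C hC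
    let hZ : ∀ M : ℕ+, Nonempty (ModelCyclotomes.lDeltaQuot (C.rigidData (τ.modAll M) hC hS h15 L) ≃*
        Literature.IUT.HodgeTheaters.ZHat) := fun M =>
      ModelCyclotomes.nonempty_lDeltaQuot_rigidData_mulEquiv_zHat C (τ.modAll M) hC hS h15 L hO hYcl hlp.ne_zero
    let hq : Nonempty (TopGroup.quot (EtaleLevels.setting C hC hS hlp hp2 hpl hζ τ.modAll f hf).PiX
        (EtaleLevels.setting C hC hS hlp hp2 hpl hζ τ.modAll f hf).DeltaX ≃ₜ*
          (EtaleLevels.setting C hC hS hlp hp2 hpl hζ τ.modAll f hf).Gk) :=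
      hq_setting_modelTate p l hl hlp hdvd τ
    haveI : CompactSpace (EtaleLevels.setting C hC hS hlp hp2 hpl hζ τ.modAll f hf).Gk :=
      EtaleLevels.compactSpace_Gk C hC hS hlp hp2 hpl hζ τ.modAll f hf
    ∀ (hext : ∀ γ : ↥C.Huu ≃ₜ* ↥C.Huu, ∃ Γ : PiTpχq p 1 2 ≃ₜ* PiTpχq p 1 2,
        (∀ h : C.Huu, Γ (h : PiTpχq p 1 2) = ((γ h : C.Huu) : PiTpχq p 1 2)) ∧
          (curveχq p 1 2).DeltaTemp.map Γ.toMulEquiv.toMonoidHom = (curveχq p 1 2).DeltaTemp)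
      (hHGAL : ∀ α : (EtaleThetaDataOfSetting.Pi C) ≃ₜ* (EtaleThetaDataOfSetting.Pi C),
        ∃ σ : GQp p, ∀ x : EtaleThetaDataOfSetting.Pi C,
          EtaleThetaDataOfSetting.aug C (α x) = σ * EtaleThetaDataOfSetting.aug C x * σ⁻¹),
    let h218i : ∀ M : ℕ+, (EtaleLevels.levelRigid C hC hS τ.modAll h15 L M).Cor218_i :=
      (cor111_record_inputs_modelTate_of_extends p l hl hlp hdvd τ hext).1
    let hΔ : ∀ g : (EtaleLevels.setting C hC hS hlp hp2 hpl hζ τ.modAll f hf).PiX ≃ₜ*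
          (EtaleLevels.setting C hC hS hlp hp2 hpl hζ τ.modAll f hf).PiX,
        (EtaleLevels.setting C hC hS hlp hp2 hpl hζ τ.modAll f hf).DeltaX.map g.toMulEquiv.toMonoidHom =
          (EtaleLevels.setting C hC hS hlp hp2 hpl hζ τ.modAll f hf).DeltaX :=
      (cor111_record_inputs_modelTate_of_extends p l hl hlp hdvd τ hext).2
    ∃ (R : GalRigidityInput
        (AbsTopMonoids.genuineOfModel (EtaleLevels.setting C hC hS hlp hp2 hpl hζ τ.modAll f hf)
          (ThetaSetting.modelχq p 1 2 even_two).toTemperedCurve.mlfClosure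
          (ThetaSetting.modelχq p 1 2 even_two).toTemperedCurve.galoisEpsilon hΔ hq))
      (I : GalCorPiXInput
        (AbsTopMonoids.genuineOfModel (EtaleLevels.setting C hC hS hlp hp2 hpl hζ τ.modAll f hf)
          (ThetaSetting.modelχq p 1 2 even_two).toTemperedCurve.mlfClosure
          (ThetaSetting.modelχq p 1 2 even_two).toTemperedCurve.galoisEpsilon hΔ hq)
        (EtaleLevels.familyLim C hC hS hlp hp2 hpl hζ τ.modAll f hf τ.red_modAll h15 L hZ (h218i 1))),
      ((ex18iii (EtaleLevels.setting C hC hS hlp hp2 hpl hζ τ.modAll f hf) Γ').toDagger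
        (cor111FunctorCor110 (GalTwistInput.ofZHat (EtaleLevels.setting C hC hS hlp hp2 hpl hζ τ.modAll f hf)) R
          (EtaleLevels.familyLim C hC hS hlp hp2 hpl hζ τ.modAll f hf τ.red_modAll h15 L hZ (h218i 1)) I Γ Γ')).IsMultiradiallyDefined := by
  intro hC hS K₀ C h15 L hO hYcl hp2 hpl hζ f hf hZ hq hext hHGAL h218i hΔ
  exact exists_cor111FunctorCor110_modelTate p l hl hlp hdvd τ Γ Γ' h218i hΔ hHGAL

end ModelTateCarriers

/-! ## §4. The Prop. 1.5 record of the Tate model (abc-iut-w4-d038 p454451) RE-KEYED likewise -/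

namespace EtaleLevels

variable (p : ℕ) [Fact p.Prime] (l : ℕ+) (hlo : Odd (l : ℕ))
  (hl : (l : ℕ).Prime) (hp2 : p ≠ 2) (hpl : p ≠ l) (hζ : ∃ ζ : (ThetaSetting.modelTate p).K, IsPrimitiveRoot ζ (4 * l))
  {Es : Set ℕ+} (τ : (ThetaSetting.modelTate p).CyclotomeTower l Es)

include hζ in
/-- **[IUTchII] Prop. 1.5 (i) (printed form) ∧ (ii) for the NATURAL system of the `X̲̲` OF RECORD over the Tate instance, with the
F-0620 binder at the chain levels `τ.mod e` SUPPLIED from `hextΔ`**: abc-iut-w4-d038's `prop15_modelSystem_modelTate` (section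
`inr`, class `η̈♯`, `X̲̲ := Huuχq`, EMPTY cusp labelling; seven model binders already supplied there) with `h218i` :=
abc-iut-L6-d6's `rigidData_cor218_i_modelχq_of_extends_of_mod_four_eq_one`, `p ≡ 1 (mod 4)` from the record's own `ζ_{4l} ∈ ℚ_p`
(`mod_four_eq_one_of_isPrimitiveRoot_bot`). Displayed Prop binders: `hextΔ`, `h219iii` (`ThetaEnvTower.Cor219_iii`), the side
conditions `l` odd prime, `p ≠ 2`, `p ≠ l`, `ζ_{4l} ∈ K`. [claim: Mochizuki2012, status: disputed] (IUTchII §1 Prop 1.5, kurims p.29) -/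
theorem prop15_modelSystem_modelTate_of_extends :
    let E := ((kummerCoreχq p 1 2 even_two).toKummerDataOfSection SemidirectProduct.inr (continuous_inrχq p 1 2)
        (fun _ => rfl) (map_inr_GK_le_GtpY_modelχq' p 1 2 even_two)
        (map_inr_GKdd_le_GtpYdd_modelχq' p 1 2 even_two)).etaleThetaDataOfClass (etaDdχq p 1 2 even_two)
    let C := E.doubleUnderlineχqOfEtaRes p 1 2 l hlo (eta_res_etaDdχq p 1 2 even_two l hlo)
    let hC := compat_modelχq p 1 2 even_two
    let hS := ThetaSetting.modelχq_sec2Hyps p 1 2 even_two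
    let h15 := prop15iii_etaleThetaDataOfClass_etaDdχq p hC SemidirectProduct.inr (continuous_inrχq p 1 2)
        (fun _ => rfl) (map_inr_GK_le_GtpY_modelχq' p 1 2 even_two) (map_inr_GKdd_le_GtpYdd_modelχq' p 1 2 even_two)
    let L : C.CuspLabels := ⟨fun _ => ∅, fun _ => ∅, fun _ => rfl⟩
    ∀ (f : contCocycles (ThetaSetting.modelTate p).toTheta (ThetaSetting.modelTate p).DeltaTheta C.GtpYdduu)
      (hf : f ∈ C.rootCocycles hC)
      (hext : ∀ γ : ↥C.Huu ≃ₜ* ↥C.Huu, ∃ Γ : PiTpχq p 1 2 ≃ₜ* PiTpχq p 1 2,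
        (∀ h : C.Huu, Γ (h : PiTpχq p 1 2) = ((γ h : C.Huu) : PiTpχq p 1 2)) ∧
          (curveχq p 1 2).DeltaTemp.map Γ.toMulEquiv.toMonoidHom = (curveχq p 1 2).DeltaTemp)
      (h219iii : (C.thetaEnvTower τ hC hS).Cor219_iii),
    (modelSystem C hC hS hl hp2 hpl hζ τ.modAll f hf τ.red_modAll h15 L (fun M =>
      ModelCyclotomes.nonempty_lDeltaQuot_rigidData_mulEquiv_zHat C (τ.modAll M) hC hS h15 L
        (ThetaSetting.modelχq_isEtThOrigin p 1 2 even_two) (hYcl_modelχq p 1 2 even_two) hl.ne_zero)).transitionsAreIsos ∧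
    ∀ (B : MonoThetaProjSystem (modelFamily C hC hS hl hp2 hpl hζ τ.modAll f hf)),
      B.IsMonoThetaCompatible (reductions C hC hS hl hp2 hpl hζ τ.modAll f hf τ.red_modAll (isSlimGroup_PiTpχq p 1 2)) →
      Prop15_i (modelSystem C hC hS hl hp2 hpl hζ τ.modAll f hf τ.red_modAll h15 L (fun M =>
        ModelCyclotomes.nonempty_lDeltaQuot_rigidData_mulEquiv_zHat C (τ.modAll M) hC hS h15 L
          (ThetaSetting.modelχq_isEtThOrigin p 1 2 even_two) (hYcl_modelχq p 1 2 even_two) hl.ne_zero)) B := by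
  intro E C hC hS h15 L f hf hext h219iii
  obtain ⟨ζ, hζ4⟩ := hζ
  exact prop15_modelSystem_modelTate p l hlo hl hp2 hpl ⟨ζ, hζ4⟩ τ f hf
    (fun e => rigidData_cor218_i_modelχq_of_extends_of_mod_four_eq_one p 1
      (mod_four_eq_one_of_isPrimitiveRoot_bot p l.pos hζ4) C (τ.mod e) hC hS h15 hext) h219iii

end EtaleLevels

end Literature.IUT.HodgeArakelov

end
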